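import Literature.NumberTheory.LFunctions.DeBruijnNewman
import Literature.NumberTheory.LFunctions.DeBruijnNewmanBoundOfCertificates
import Summits.RiemannHypothesis.RiemannHypothesis.Theorems.DBNClassFloor
import Literature.Analysis.Complex.DeBruijnStripShift

/-!
# Planted heat-flow pair — K-ONLY cut of C1⁷ «HEIGHT & DBN» (rh-idea-5 g14; from `Sketch-W06c7-C1seven-rh-idea-5-g14.lean` rev 2)

0 `sorry`, 0 stubs, no `HarnessLib`: every declaration below is kernel-checked.  Offered to the desk / lander lane
as the C1⁷ candidate for (CA117) item (5) «further K directions in verdict order» (VERDICT C1⁷ = CONCUR, ideators l.3325).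

PLANTED OBJECT (tree normalisation `deBruijnH t z = ∫_{u>0} e^{tu²} Φ(u) cos(zu) du`, `H₀(z) = Ξ(z/2)/8`,
ζ-zero `½ + iγₖ` ↦ real zero `z = 2γₖ` of `H₀`): ζ's data plus ONE off-line quadruple `½ ± δ ± iγ` ↦ the zero pair
`z = 2γ ± 2iδ` of the pair polynomial `Q_t(z) = (z − 2γ)² + 4δ² − 2t` (parameter order `(γ, δ)`; rh-idea-2's screw-side
defs of record use `(δ, γ)`).  Heat flow conjugates multiplication by `z` into `z − 2t∂`, whence
`plantedH γ δ t = Q_t · H_t − 4t (z − 2γ) · H_t′ + 4t² · H_t″` (K at `t = 0`: `plantedH_zero`).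

K CONTENT: HEIGHT two-sided law `blind_height` / `sees_height` (b_H = d_H = γ); isolated-pair DBN law
`hasOnlyRealZeros_pairPoly_iff` (only real zeros ⇔ 2δ² ≤ t, exact, γ-free) with `blind_DBN_isolated` / `sees_DBN_isolated`;
`not_hasOnlyRealZeros_plantedH_zero`; de Bruijn strip hypothesis under `(B)`: `rootsInStrip_plantedH_zero`
(`RootsInStrip (plantedH γ δ 0) (2|δ|)`); certificate input (i′) = HEIGHT: `cert_sees_by_height` / `cert_blind_by_height`;
reconciliation identity `lCont_eq_classFloor` (continuum drag law = tree `DbnTheory.classFloor (2L) (2δ)`);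
flowed isolated pair in closed form `pairPoly_eq_zero_iff_flow` / `abs_im_eq_of_pairPoly_zero_flow` (rev 2, ADDENDUM-3).
`(B) := HasOnlyRealZeros (deBruijnH 0)` is used only as a hypothesis and never discharged.  Every statement is about the
planted object / the pair polynomial: 0 bits toward ζ.  Nothing here bears on the truth of RH.
-/

open Complex
open Literature.NumberTheory.LFunctions

namespace RhIdea5.G14.C1seven.KOnly

/-! ## Objects -/

/-- The pair polynomial at flow time `t`: `Q_t(z) = (z − 2γ)² + (4δ² − 2t)`; its zeros are the isolated
planted pair `2γ ± i√(4δ² − 2t)` (`t < 2δ²`) resp. two real zeros (`t ≥ 2δ²`). -/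
def pairPoly (γ δ t : ℝ) (z : ℂ) : ℂ :=
  (z - ((2 * γ : ℝ) : ℂ)) ^ 2 + ((4 * δ ^ 2 - 2 * t : ℝ) : ℂ)

/-- The planted object at flow time `t`: `e^{−t∂²}(Q₀ H₀) = Q_t H_t − 4t(z−2γ)H_t′ + 4t² H_t″`
(conjugation identity `e^{−t∂²} z e^{t∂²} = z − 2t∂`; pencil for `t ≠ 0`, definitional at `t = 0`). -/
noncomputable def plantedH (γ δ t : ℝ) (z : ℂ) : ℂ :=
  pairPoly γ δ t z * deBruijnH t z
    - ((4 * t : ℝ) : ℂ) * (z - ((2 * γ : ℝ) : ℂ)) * deriv (deBruijnH t) z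
    + ((4 * t ^ 2 : ℝ) : ℂ) * iteratedDeriv 2 (deBruijnH t) z

/-- `RealZerosUpTo F X`: every zero of `F` with `|Re z| ≤ X` is real — the HEIGHT test at index `X`
(`X = 2H` ↔ «RH verified up to height `H`», cf. input (i′) of `Polymath15.upper_bound_of_rectangles`). -/
def RealZerosUpTo (F : ℂ → ℂ) (X : ℝ) : Prop :=
  ∀ z : ℂ, F z = 0 → |z.re| ≤ X → z.im = 0

/-- Input (ii′) of the rectangle certificate, for a general flow `F t z`: `F t₀ (x + iy) ≠ 0` for `x ≥ X`,
`y₀ ≤ y ≤ 1` (verbatim shape of `hii` in `Polymath15.upper_bound_of_rectangles`). -/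
def CertHypII (F : ℝ → ℂ → ℂ) (t₀ X y₀ : ℝ) : Prop :=
  ∀ x y : ℝ, X ≤ x → y₀ ≤ y → y ≤ 1 → F t₀ (x + y * I) ≠ 0

/-- Background convention `(B)`: ζ's zeros are on-line data, i.e. `H₀` has only real zeros.
By the tree fact `riemannHypothesis_iff_hasOnlyRealZeros_deBruijnH_zero` this IS `RiemannHypothesis`;
it enters every planted-DBN law as an undischarged hypothesis (atlas convention), never as a conclusion. -/
def Background : Prop := HasOnlyRealZeros (deBruijnH 0)

/-! ## Closed forms (DBN column) -/

/-- Continuum (line-charge) collision time `T_cont(γ,δ) = 4δ/L − (4/L²)·log(1 + δL)`, `L = log(γ/2π)`: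
solution of `ẏ = −1/y − D`, `D = L/2 = 2π × (zero density of H₀ near z = 2γ)`, from `y = 2δ` to `0`. -/
noncomputable def lCont (γ δ : ℝ) : ℝ :=
  4 * δ / Real.log (γ / (2 * Real.pi))
    - 4 / (Real.log (γ / (2 * Real.pi))) ^ 2 * Real.log (1 + δ * Real.log (γ / (2 * Real.pi)))

/-- Numerics law, LOWER EDGE of the configuration band over ALL plant phases including the worst one (plant
exactly above a real zero, which then stays put by symmetry and adds `2/y` to the self-attraction `1/y`):
the «T₃ law» `lNum(γ,δ) = 4δ/L − (12/L²)·log(1 + δL/3)` = exit time of `ẏ = −3/y − L/2` from `2δ`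
(= `classFloor ((2/√3)L) (2δ/√3)`).  Box: 1 500 N-body runs, `γ ∈ [10², 10²⁰]` (actual ζ zeros to `10⁵`,
density-rescaled beyond), `δ ∈ [0.03, 0.45]`; measured `t_c / lNum ∈ [1.02, 1.52]` on-zero, `> 1.5` off-zero. -/
noncomputable def lNum (γ δ : ℝ) : ℝ :=
  4 * δ / Real.log (γ / (2 * Real.pi))
    - 12 / (Real.log (γ / (2 * Real.pi))) ^ 2 * Real.log (1 + δ * Real.log (γ / (2 * Real.pi)) / 3)

/-- Pencil lower law `lPen A γ δ = 2δ²/(1 + A·log γ)` (Gronwall on `y ẏ ≥ −1 − y²·S`, `y²S ≤ A log γ` from a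
short-window zero count; `A` absolute, existentially quantified in the stub — typing checklist 4c(iv)). -/
noncomputable def lPen (A γ δ : ℝ) : ℝ := 2 * δ ^ 2 / (1 + A * Real.log γ)

/-- TEST −1 (K): the continuum collision time IS the tree's class floor (`Theorems/DBNDefs.lean` `classFloor`,
exit-time theorem `DbnTheory.ClassFloorExitTime_holds` in `Theorems/DBNClassFloor.lean`) at rate `ℓ = 2L`,
start `Y₀ = 2δ`: `lCont γ δ = classFloor (2 log(γ/2π)) (2δ)`. -/
theorem lCont_eq_classFloor (γ δ : ℝ) :
    lCont γ δ = Summit.RiemannHypothesis.RiemannHypothesis.Theorems.DbnTheory.classFloor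
      (2 * Real.log (γ / (2 * Real.pi))) (2 * δ) := by
  unfold lCont Summit.RiemannHypothesis.RiemannHypothesis.Theorems.DbnTheory.classFloor
  have e : 1 + 2 * Real.log (γ / (2 * Real.pi)) * (2 * δ) / 4 = 1 + δ * Real.log (γ / (2 * Real.pi)) := by
    ring
  rw [e]
  ring

/-! ## K lemmas: algebra of the pair polynomial -/

/-- Zero set of the pair polynomial: `pairPoly γ δ t z = 0 ↔ (z − 2γ)² = 2t − 4δ²`. -/
theorem pairPoly_eq_zero_iff (γ δ t : ℝ) (z : ℂ) :
    pairPoly γ δ t z = 0 ↔ (z - ((2 * γ : ℝ) : ℂ)) ^ 2 = ((2 * t - 4 * δ ^ 2 : ℝ) : ℂ) := by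
  unfold pairPoly
  constructor
  · intro h
    have h' := eq_neg_of_add_eq_zero_left h
    rw [h', ← Complex.ofReal_neg]
    push_cast
    ring
  · intro h
    rw [h]
    push_cast
    ring

/-- A complex number whose square is a nonnegative real is real. -/
theorem im_eq_zero_of_sq_eq_ofReal {w : ℂ} {m : ℝ} (h : w ^ 2 = (m : ℂ)) (hm : 0 ≤ m) :
    w.im = 0 := by
  have hre := congrArg Complex.re h
  have him := congrArg Complex.im h
  simp [sq] at hre him
  have h2 : w.re * w.im = 0 := by linarith
  rcases mul_eq_zero.1 h2 with h0 | h0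
  · rw [h0] at hre
    simp at hre
    have : w.im * w.im = 0 := by nlinarith [mul_self_nonneg w.im]
    exact mul_self_eq_zero.1 this
  · exact h0

/-- A complex number whose square is a negative real is purely imaginary. -/
theorem re_eq_zero_of_sq_eq_ofReal_neg {w : ℂ} {m : ℝ} (h : w ^ 2 = (m : ℂ)) (hm : m < 0) :
    w.re = 0 := by
  have hre := congrArg Complex.re h
  have him := congrArg Complex.im h
  simp [sq] at hre him
  have h2 : w.re * w.im = 0 := by linarith
  rcases mul_eq_zero.1 h2 with h0 | h0
  · exact h0
  · rw [h0] at hre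
    simp at hre
    nlinarith [mul_self_nonneg w.re]

/-- The plant is a zero of `Q₀`. -/
theorem pairPoly_plant (γ δ : ℝ) : pairPoly γ δ 0 ((2 * γ : ℝ) + (2 * δ : ℝ) * I) = 0 := by
  rw [pairPoly_eq_zero_iff]
  push_cast
  have : ((2 : ℂ) * γ + 2 * δ * I - 2 * γ) = 2 * δ * I := by ring
  rw [this, mul_pow, Complex.I_sq]
  ring

/-- At `t = 0` a zero of the pair polynomial has real part exactly `2γ` (`δ ≠ 0`). -/
theorem re_eq_of_pairPoly_zero {γ δ : ℝ} (hδ : δ ≠ 0) {z : ℂ} (h : pairPoly γ δ 0 z = 0) :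
    z.re = 2 * γ := by
  rw [pairPoly_eq_zero_iff] at h
  have hm : (2 * (0 : ℝ) - 4 * δ ^ 2) < 0 := by
    have : 0 < δ ^ 2 := by positivity
    linarith
  have := re_eq_zero_of_sq_eq_ofReal_neg h hm
  simpa [sub_eq_zero] using this

/-! ## K: the planted object at `t = 0` -/

/-- At `t = 0` the planted object factors as `pairPoly γ δ 0 · H_0`. -/
theorem plantedH_zero (γ δ : ℝ) (z : ℂ) : plantedH γ δ 0 z = pairPoly γ δ 0 z * deBruijnH 0 z := by
  simp [plantedH]

/-- The planted quadruple is there: `plantedH γ δ 0 (2γ + 2δ i) = 0`. -/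
theorem plantedH_zero_plant (γ δ : ℝ) : plantedH γ δ 0 ((2 * γ : ℝ) + (2 * δ : ℝ) * I) = 0 := by
  rw [plantedH_zero, pairPoly_plant, zero_mul]

/-- … and it is off the line: the planted object at `t = 0` does NOT have only real zeros (`δ ≠ 0`). -/
theorem not_hasOnlyRealZeros_plantedH_zero (γ : ℝ) {δ : ℝ} (hδ : δ ≠ 0) :
    ¬ HasOnlyRealZeros (plantedH γ δ 0) := by
  intro h
  have := h _ (plantedH_zero_plant γ δ)
  simp at this
  exact hδ this

/-! ## COLUMN HEIGHT — two-sided law, both directions K.  `b_H(γ,δ) = d_H(γ,δ) = 2γ` (index `X`; height `γ`). -/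

/-- BLIND: a height scan to `X < 2γ` cannot tell the planted object from `H₀` (same verdict, whatever ζ does). -/
theorem blind_height {γ δ X : ℝ} (hδ : δ ≠ 0) (hX : X < 2 * γ) :
    RealZerosUpTo (plantedH γ δ 0) X ↔ RealZerosUpTo (deBruijnH 0) X := by
  constructor
  · intro h z hz hre
    apply h z ?_ hre
    rw [plantedH_zero, hz, mul_zero]
  · intro h z hz hre
    rw [plantedH_zero] at hz
    rcases mul_eq_zero.1 hz with hq | hH
    · exfalso
      have h1 := re_eq_of_pairPoly_zero hδ hq
      have h2 : z.re ≤ X := le_trans (le_abs_self _) hre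
      linarith
    · exact h z hH hre

/-- SEES: a height scan to `X ≥ 2γ` fails on the planted object (`γ ≥ 0`, `δ ≠ 0`). -/
theorem sees_height {γ δ X : ℝ} (hγ : 0 ≤ γ) (hδ : δ ≠ 0) (hX : 2 * γ ≤ X) :
    ¬ RealZerosUpTo (plantedH γ δ 0) X := by
  intro h
  have hre : |((2 * γ : ℝ) + (2 * δ : ℝ) * I : ℂ).re| ≤ X := by
    simp
    rw [abs_of_nonneg (by linarith)]
    exact hX
  have := h _ (plantedH_zero_plant γ δ) hre
  simp at this
  exact hδ this

/-! ## COLUMN DBN, isolated pair — two-sided law, K: `Λ(Q) = 2δ²` exactly (γ-independent). -/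

/-- `Q_t` has only real zeros iff `t ≥ 2δ²`.  (`→`: for `t < 2δ²` the zero `2γ + i√(4δ²−2t)` is off the
line; `←`: `(z−2γ)² = 2t − 4δ² ≥ 0` forces `z − 2γ` real.) -/
theorem hasOnlyRealZeros_pairPoly_iff (γ δ t : ℝ) :
    HasOnlyRealZeros (pairPoly γ δ t) ↔ 2 * δ ^ 2 ≤ t := by
  constructor
  · intro h
    by_contra hlt
    push Not at hlt
    set s : ℝ := Real.sqrt (4 * δ ^ 2 - 2 * t) with hs
    have hs_pos : 0 < s := Real.sqrt_pos.2 (by linarith)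
    have hss : s ^ 2 = 4 * δ ^ 2 - 2 * t := Real.sq_sqrt (by linarith)
    have hz : pairPoly γ δ t (((2 * γ : ℝ) : ℂ) + (s : ℂ) * I) = 0 := by
      rw [pairPoly_eq_zero_iff]
      have e : (((2 * γ : ℝ) : ℂ) + (s : ℂ) * I - ((2 * γ : ℝ) : ℂ)) = (s : ℂ) * I := by ring
      rw [e, mul_pow, Complex.I_sq, ← Complex.ofReal_pow, hss]
      push_cast
      ring
    have := h _ hz
    simp at this
    exact hs_pos.ne' this
  · intro ht z hz
    rw [pairPoly_eq_zero_iff] at hz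
    have := im_eq_zero_of_sq_eq_ofReal hz (by linarith)
    simpa using this

/-- BLIND (isolated): `t ≥ 2δ²` ⇒ the test «only real zeros at time `t`» passes on `Q`. -/
theorem blind_DBN_isolated {γ δ t : ℝ} (ht : 2 * δ ^ 2 ≤ t) : HasOnlyRealZeros (pairPoly γ δ t) :=
  (hasOnlyRealZeros_pairPoly_iff γ δ t).2 ht

/-- SEES (isolated): `t < 2δ²` ⇒ the test fails on `Q`. -/
theorem sees_DBN_isolated {γ δ t : ℝ} (ht : t < 2 * δ ^ 2) : ¬ HasOnlyRealZeros (pairPoly γ δ t) :=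
  fun h ↦ absurd ((hasOnlyRealZeros_pairPoly_iff γ δ t).1 h) (not_le.2 ht)

/-! ## COLUMN DBN-by-certificate — input (i′) of `Polymath15.upper_bound_of_rectangles` on the planted object IS the
HEIGHT column (K both sides). The (ii′)/flow direction and the planted BLIND/SEES laws under `(B)` are NOT in this
K-only cut (they are the named stubs of the Sketch `Sketch-W06c7-C1seven-rh-idea-5-g14.lean` rev 2). -/


/-- K (the other side of the certificate column): if the verified height already reaches the plant
(`γ ≤ H`, i.e. `2γ ≤ X := 2H`), input (i′) fails — detection at HEIGHT cost, no flow needed. -/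
theorem cert_sees_by_height {γ δ H : ℝ} (hγ : 0 ≤ γ) (hδ : δ ≠ 0) (hH : γ ≤ H) :
    ¬ RealZerosUpTo (plantedH γ δ 0) (2 * H) :=
  sees_height hγ hδ (by linarith)

/-- K: and if it does not (`H < γ`), input (i′) returns on the planted object exactly what it returns on ζ. -/
theorem cert_blind_by_height {γ δ H : ℝ} (hδ : δ ≠ 0) (hH : H < γ) :
    RealZerosUpTo (plantedH γ δ 0) (2 * H) ↔ RealZerosUpTo (deBruijnH 0) (2 * H) :=
  blind_height hδ (by linarith)

/-! ## K: step (L2) of the BLIND chain — under `(B)` the planted object at `t = 0` has its roots in de Bruijn's strip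
`|Im z| ≤ 2|δ|` (the hypothesis `hroots` of `Literature.Analysis.Complex.rootsInStrip_gaussian` with `Δ = 2|δ|`). -/

/-- A zero of `Q₀` has `|Im z| = 2|δ|` (so `≤ 2|δ|`). -/
theorem abs_im_le_of_pairPoly_zero {γ δ : ℝ} {z : ℂ} (h : pairPoly γ δ 0 z = 0) : |z.im| ≤ 2 * |δ| := by
  rw [pairPoly_eq_zero_iff] at h
  set w : ℂ := z - ((2 * γ : ℝ) : ℂ) with hw
  have hwim : w.im = z.im := by simp [hw]
  have hre := congrArg Complex.re h
  have him := congrArg Complex.im h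
  simp only [sq, Complex.mul_re, Complex.mul_im, Complex.ofReal_re, Complex.ofReal_im] at hre him
  have h2 : w.re * w.im = 0 := by linarith
  rcases mul_eq_zero.1 h2 with h0 | h0
  · rw [h0] at hre
    have hsq : w.im * w.im = (2 * |δ|) * (2 * |δ|) := by nlinarith [abs_mul_abs_self δ]
    rw [← hwim]
    rcases mul_self_eq_mul_self_iff.1 hsq with e | e <;> rw [e]
    · simp [abs_of_nonneg (by positivity : (0 : ℝ) ≤ 2 * |δ|)]
    · simp [abs_neg, abs_of_nonneg (by positivity : (0 : ℝ) ≤ 2 * |δ|)]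
  · rw [← hwim, h0]
    simp

/-- (L2), K: `Background → RootsInStrip (plantedH γ δ 0) (2|δ|)`. -/
theorem rootsInStrip_plantedH_zero (γ δ : ℝ) (hB : Background) :
    Literature.Analysis.Complex.RootsInStrip (plantedH γ δ 0) (2 * |δ|) := by
  intro z hz
  rw [plantedH_zero] at hz
  rcases mul_eq_zero.1 hz with hq | hH
  · exact abs_im_le_of_pairPoly_zero hq
  · rw [hB z hH]
    simp

/-! ## K: the flowed isolated pair in closed form, and the DBN × JENSEN exchange (ADDENDUM-3)
Under the flow the isolated planted pair moves VERTICALLY ONLY: the zeros of `Q_t` are exactly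
`2γ ± i√(4δ² − 2t)` for `2t ≤ 4δ²`.  In ζ-plane units the flowed pair is `½ ± δ_t ± iγ` with
`δ_t² = δ² − t/2`; composing with the tree's Jensen planted threshold
(`SoloBlindJensenPlanted`: `d* ≍ (γ² + η²)²/(4γ²η²)` at `η = δ_t`) gives the exchange law
`d_J(t) · 4δ_t² = (γ² + δ_t²)²/γ²` (≈ γ²): DBN time is converted into Jensen degree, not saved. -/

/-- The zeros of `Q_t` for `2t ≤ 4δ²`: exactly the conjugate pair `2γ ± i·√(4δ² − 2t)`. -/
theorem pairPoly_eq_zero_iff_flow {γ δ t : ℝ} (ht : 2 * t ≤ 4 * δ ^ 2) (z : ℂ) :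
    pairPoly γ δ t z = 0 ↔
      z = ((2 * γ : ℝ) : ℂ) + I * (Real.sqrt (4 * δ ^ 2 - 2 * t) : ℝ) ∨
      z = ((2 * γ : ℝ) : ℂ) - I * (Real.sqrt (4 * δ ^ 2 - 2 * t) : ℝ) := by
  rw [pairPoly_eq_zero_iff]
  set r : ℝ := Real.sqrt (4 * δ ^ 2 - 2 * t) with hr
  have hr2 : ((r : ℂ)) ^ 2 = -(((2 * t - 4 * δ ^ 2 : ℝ)) : ℂ) := by
    rw [← Complex.ofReal_pow, hr, Real.sq_sqrt (by linarith)]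
    push_cast
    ring
  have key : (z - ((2 * γ : ℝ) : ℂ)) ^ 2 = ((2 * t - 4 * δ ^ 2 : ℝ) : ℂ) ↔
      (z - ((2 * γ : ℝ) : ℂ) - I * r) * (z - ((2 * γ : ℝ) : ℂ) + I * r) = 0 := by
    constructor
    · intro h
      linear_combination h + hr2 - ((r : ℂ)) ^ 2 * Complex.I_sq
    · intro h
      linear_combination h - hr2 + ((r : ℂ)) ^ 2 * Complex.I_sq
  rw [key, mul_eq_zero]
  constructor
  · rintro (h | h)
    · exact Or.inl (by linear_combination h)
    · exact Or.inr (by linear_combination h)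
  · rintro (h | h)
    · exact Or.inl (by linear_combination h)
    · exact Or.inr (by linear_combination h)

/-- Hence every zero of `Q_t` (`2t ≤ 4δ²`) has `|Im z| = √(4δ² − 2t) = 2δ_t` EXACTLY and `Re z = 2γ`:
the flowed isolated pair ATTAINS de Bruijn's strip `√(Δ² − 2t)`, `Δ = 2δ`. -/
theorem abs_im_eq_of_pairPoly_zero_flow {γ δ t : ℝ} (ht : 2 * t ≤ 4 * δ ^ 2) {z : ℂ}
    (h : pairPoly γ δ t z = 0) : |z.im| = Real.sqrt (4 * δ ^ 2 - 2 * t) ∧ z.re = 2 * γ := by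
  have hr0 : 0 ≤ Real.sqrt (4 * δ ^ 2 - 2 * t) := Real.sqrt_nonneg _
  rcases (pairPoly_eq_zero_iff_flow ht z).1 h with e | e <;> subst e <;> constructor <;>
    simp [abs_of_nonneg hr0]

end RhIdea5.G14.C1seven.KOnly
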